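import Summits.ABC.IUTFork.Cor312Remarks
import Summits.ABC.IUTFork.Cor312Remarks2
import Summits.ABC.IUTFork.Cor312Remarks3
import Summits.ABC.IUTFork.Cor312RemarksSmm
import Summits.ABC.IUTFork.ForkDictionary
import Summits.ABC.IUTFork.ForkGenEllShape
import Summits.ABC.IUTFork.ForkInd1
import Summits.ABC.IUTFork.ForkInd1Bridge
import Summits.ABC.IUTFork.ForkInd1Estimate
import Summits.ABC.IUTFork.ForkInd1Passive

/-!
# Kernel DAG index — layer C312, part y (MACHINE DELTA-DRAFT by abc-iut-dag `tools/mkkernel.py` @2026-08-26T03:00Z: 20 landed nodes NOT YET in the tree index Summits/ABC/IUTFork/DAG*.lean filed by abc-iut-c312-2; spec v1.3)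

THIS FILE PROVES NOTHING NEW AND ASSERTS NOTHING (plan/KERNEL-DAG-SPEC.md). It gives ONE NAME `N_<kernel_id>` to each DAG node whose
statement has LANDED through the gate, knitting the landed declarations BY NAME. Witness naming (c312-2 F1/F2, 18:39:37Z): `N_<id>_holds`
exists iff the DAG row is `discharged(p)` (it IS the kernel-checked theorems); a landed row not yet marked discharged by its lead gets the same
conjunction witnessed as `N_<id>_part`; FACT-style `def … : Prop` claims get a name and no witness; CLAIM-FORM items ([IUTchIII] Cor 3.12,
[IUTchIV] Thm 1.10) are `abbrev N_<id> (X) : Prop := X.<Claim>` and the theorems that assume them are EDGES `E_<dst>_of_<src>` (no `__`). Nothing here says abc is proved or refuted or takes a side on [IUTchIII] Cor 3.12. typed ≠ discharged; indexed ≠ endorsed.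
Filer of the tree copy: abc-iut-c312-2 (`Summits/ABC/IUTFork/DAGC312y.lean`); this draft is regenerated hourly and is not the tree.
-/

namespace Summit.ABC.IUTFork.DAG

namespace PartC312y
/-- `StatementOf h` is the statement (a `Prop`) of which the landed `h` is the proof: the index NAMES statements, it never re-types them. -/
abbrev StatementOf {P : Prop} (_h : P) : Prop := P
end PartC312y
open PartC312y

noncomputable section
universe u₁ u₂ u₃ u₄ u₅ u₆ u₇ u₈ u₉

/-- [node Fork:ForkDictionary · C312/D4 · HOME/skel/ForkDictionary.lean (102 lines; 0 structures / 1 defs / 5 theorems; imports … · p408342 · claim · DAG status discharged(p408342)] decls 6 · cites→ Fork:ForkHexagon,Fork:ForkPilots -/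
def N_Fork_ForkDictionary : Prop :=
  StatementOf @Summit.ABC.IUTFork.sum_pilotLocalDegrees ∧
  StatementOf @Summit.ABC.IUTFork.qBPS_pilot_eq_deg_qPilot ∧
  StatementOf @Summit.ABC.IUTFork.thetaDeg_pilot_eq_degLgp ∧
  StatementOf @Summit.ABC.IUTFork.thetaLink_pilot_eq_deg_qPilot ∧
  StatementOf @Summit.ABC.IUTFork.hexagon_gap_eq
/-- discharge of `N_Fork_ForkDictionary`: the landed theorems it names, BY NAME (spec §2(c)); proves nothing new. -/
theorem N_Fork_ForkDictionary_holds : N_Fork_ForkDictionary := ⟨@Summit.ABC.IUTFork.sum_pilotLocalDegrees, @Summit.ABC.IUTFork.qBPS_pilot_eq_deg_qPilot, @Summit.ABC.IUTFork.thetaDeg_pilot_eq_degLgp, @Summit.ABC.IUTFork.thetaLink_pilot_eq_deg_qPilot, @Summit.ABC.IUTFork.hexagon_gap_eq⟩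
example := @Summit.ABC.IUTFork.pilotLocalDegrees

/-- [node Fork:ForkGenEllShape · C312/D4 · HOME/skel/ForkGenEllShape.lean (216 lines; 1 structures / 2 defs / 5 theorems; imports … · p409556 · claim · DAG status discharged(p409556)] decls 8 · cites→ - -/
def N_Fork_ForkGenEllShape : Prop :=
  StatementOf @Summit.ABC.IUTFork.MovedFamily.dP_le ∧
  StatementOf @Summit.ABC.IUTFork.MovedFamily.vojta_of_vojta_moved ∧
  StatementOf @Summit.ABC.IUTFork.MovedFamily.choice_admissible ∧
  StatementOf @Summit.ABC.IUTFork.MovedFamily.vojta_reduction ∧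
  StatementOf @Summit.ABC.IUTFork.no_bounded_discrepancy
/-- discharge of `N_Fork_ForkGenEllShape`: the landed theorems it names, BY NAME (spec §2(c)); proves nothing new. -/
theorem N_Fork_ForkGenEllShape_holds : N_Fork_ForkGenEllShape := ⟨@Summit.ABC.IUTFork.MovedFamily.dP_le, @Summit.ABC.IUTFork.MovedFamily.vojta_of_vojta_moved, @Summit.ABC.IUTFork.MovedFamily.choice_admissible, @Summit.ABC.IUTFork.MovedFamily.vojta_reduction, @Summit.ABC.IUTFork.no_bounded_discrepancy⟩
example := @Summit.ABC.IUTFork.MovedFamily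
example := @Summit.ABC.IUTFork.MovedFamily.VojtaOrig
example := @Summit.ABC.IUTFork.MovedFamily.VojtaMoved

/-- [node Fork:ForkInd1 · C312/D4 · HOME/skel/ForkInd1.lean (395 lines; 1 structures / 6 defs / 20 theorems; imports Mathlib/Literature … · p408348 · claim · DAG status discharged(p408348)] decls 27 · cites→ - -/
def N_Fork_ForkInd1 : Prop :=
  StatementOf @Summit.ABC.IUTFork.Ind1StepV.tupleLam_pos ∧
  StatementOf @Summit.ABC.IUTFork.Ind1StepV.sum_tupleLam_pos ∧
  StatementOf @Summit.ABC.IUTFork.Ind1StepV.aggregate_mono ∧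
  StatementOf @Summit.ABC.IUTFork.Ind1StepV.aggregate_gainAt ∧
  StatementOf @Summit.ABC.IUTFork.Ind1StepV.aggregate_gainSymm ∧
  StatementOf @Summit.ABC.IUTFork.Ind1StepV.aggregate_gainAt_eq_aggregate_gainSymm ∧
  StatementOf @Summit.ABC.IUTFork.Ind1StepV.gainMin_le_gainAt ∧
  StatementOf @Summit.ABC.IUTFork.Ind1StepV.gainMin_le_gainSymm ∧
  StatementOf @Summit.ABC.IUTFork.Ind1StepV.aggregate_gainMin_le ∧
  StatementOf @Summit.ABC.IUTFork.Ind1StepV.gainMin_eq_gainAt_of_const ∧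
  StatementOf @Summit.ABC.IUTFork.Ind1StepV.aggregate_gainMin_eq_of_const ∧
  StatementOf @Summit.ABC.IUTFork.Ind1StepV.aggregate_gainMin_eq_of_subsingleton
/-- discharge of `N_Fork_ForkInd1`: the landed theorems it names, BY NAME (spec §2(c)); proves nothing new. -/
theorem N_Fork_ForkInd1_holds : N_Fork_ForkInd1 := ⟨@Summit.ABC.IUTFork.Ind1StepV.tupleLam_pos, @Summit.ABC.IUTFork.Ind1StepV.sum_tupleLam_pos, @Summit.ABC.IUTFork.Ind1StepV.aggregate_mono, @Summit.ABC.IUTFork.Ind1StepV.aggregate_gainAt, @Summit.ABC.IUTFork.Ind1StepV.aggregate_gainSymm, @Summit.ABC.IUTFork.Ind1StepV.aggregate_gainAt_eq_aggregate_gainSymm, @Summit.ABC.IUTFork.Ind1StepV.gainMin_le_gainAt, @Summit.ABC.IUTFork.Ind1StepV.gainMin_le_gainSymm, @Summit.ABC.IUTFork.Ind1StepV.aggregate_gainMin_le, @Summit.ABC.IUTFork.Ind1StepV.gainMin_eq_gainAt_of_const, @Summit.ABC.IUTFork.Ind1StepV.aggregate_gainMin_eq_of_const, @Summit.ABC.I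UTFork.Ind1StepV.aggregate_gainMin_eq_of_subsingleton⟩
-- (+8 further theorems of this node not conjoined in the draft)
example := @Summit.ABC.IUTFork.Ind1StepV.gainAt
example := @Summit.ABC.IUTFork.Ind1StepV.gainSymm
example := @Summit.ABC.IUTFork.Ind1StepV.gainMin
example := @Summit.ABC.IUTFork.Ind1StepV.aggregate
example := @Summit.ABC.IUTFork.Ind1StepV.ExponentBoxes
example := @Summit.ABC.IUTFork.Ind1StepV.ExponentBoxes.ContainsAllSlots

/-- [node Fork:ForkInd1Bridge · C312/D4 · HOME/skel/ForkInd1Bridge.lean (80 lines; 0 structures / 0 defs / 6 theorems; imports ForkInd1) · p408727 · claim · DAG status discharged(p408727)] decls 6 · cites→ Fork:ForkInd1 -/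
def N_Fork_ForkInd1Bridge : Prop :=
  StatementOf @Summit.ABC.IUTFork.Ind1StepV.aggregate_eq_wavg ∧
  StatementOf @Summit.ABC.IUTFork.Ind1StepV.gainMin_eq_tupleMin ∧
  StatementOf @Summit.ABC.IUTFork.Ind1StepV.aggregate_gainMin_eq_minAvg ∧
  StatementOf @Summit.ABC.IUTFork.Ind1StepV.aggregate_gainAt_eq_avg ∧
  StatementOf @Summit.ABC.IUTFork.Ind1StepV.aggregate_gainSymm_eq_avg ∧
  StatementOf @Summit.ABC.IUTFork.Ind1StepV.fork_dstLocal
/-- discharge of `N_Fork_ForkInd1Bridge`: the landed theorems it names, BY NAME (spec §2(c)); proves nothing new. -/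
theorem N_Fork_ForkInd1Bridge_holds : N_Fork_ForkInd1Bridge := ⟨@Summit.ABC.IUTFork.Ind1StepV.aggregate_eq_wavg, @Summit.ABC.IUTFork.Ind1StepV.gainMin_eq_tupleMin, @Summit.ABC.IUTFork.Ind1StepV.aggregate_gainMin_eq_minAvg, @Summit.ABC.IUTFork.Ind1StepV.aggregate_gainAt_eq_avg, @Summit.ABC.IUTFork.Ind1StepV.aggregate_gainSymm_eq_avg, @Summit.ABC.IUTFork.Ind1StepV.fork_dstLocal⟩

/-- [node Fork:ForkInd1Estimate · C312/D4 · HOME/skel/ForkInd1Estimate.lean (174 lines; 0 structures / 3 defs / 8 theorems; imports ForkThm110) · p408805 · claim · DAG status discharged(p408805)] decls 11 · cites→ Fork:ForkThm110 -/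
def N_Fork_ForkInd1Estimate : Prop :=
  StatementOf @Summit.ABC.IUTFork.Thm110Data.bracketWith_one ∧
  StatementOf @Summit.ABC.IUTFork.Thm110Data.estimateWith_one_iff ∧
  StatementOf @Summit.ABC.IUTFork.Thm110Data.bracketWith_antitone ∧
  StatementOf @Summit.ABC.IUTFork.Thm110Data.estimateWith_mono ∧
  StatementOf @Summit.ABC.IUTFork.Thm110Data.displayWith_of_cor312 ∧
  StatementOf @Summit.ABC.IUTFork.Thm110Data.logq_le_of_cor312 ∧
  StatementOf @Summit.ABC.IUTFork.Thm110Data.no_bound_at_zero ∧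
  StatementOf @Summit.ABC.IUTFork.Thm110Data.stakes
/-- discharge of `N_Fork_ForkInd1Estimate`: the landed theorems it names, BY NAME (spec §2(c)); proves nothing new. -/
theorem N_Fork_ForkInd1Estimate_holds : N_Fork_ForkInd1Estimate := ⟨@Summit.ABC.IUTFork.Thm110Data.bracketWith_one, @Summit.ABC.IUTFork.Thm110Data.estimateWith_one_iff, @Summit.ABC.IUTFork.Thm110Data.bracketWith_antitone, @Summit.ABC.IUTFork.Thm110Data.estimateWith_mono, @Summit.ABC.IUTFork.Thm110Data.displayWith_of_cor312, @Summit.ABC.IUTFork.Thm110Data.logq_le_of_cor312, @Summit.ABC.IUTFork.Thm110Data.no_bound_at_zero, @Summit.ABC.IUTFork.Thm110Data.stakes⟩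
example := @Summit.ABC.IUTFork.Thm110Data.bracketWith
example := @Summit.ABC.IUTFork.Thm110Data.CThetaWith
example := @Summit.ABC.IUTFork.Thm110Data.EstimateWith

/-- [node Fork:ForkInd1Passive · C312/D4 · HOME/skel/ForkInd1Passive.lean (153 lines; 1 structures / 3 defs / 7 theorems; imports … · p409269 · claim · DAG status discharged(p409269)] decls 11 · cites→ - -/
def N_Fork_ForkInd1Passive : Prop :=
  StatementOf @Summit.ABC.IUTFork.Ind1Passive.Setting.passiveVol_smul ∧
  StatementOf @Summit.ABC.IUTFork.Ind1Passive.Setting.passiveVol_le_activeVol ∧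
  StatementOf @Summit.ABC.IUTFork.Ind1Passive.Setting.activeVol_eq_passiveVol_of_invariant ∧
  StatementOf @Summit.ABC.IUTFork.Ind1Passive.Setting.certified_iff ∧
  StatementOf @Summit.ABC.IUTFork.Ind1Passive.Setting.setLevel_forces_active ∧
  StatementOf @Summit.ABC.IUTFork.Ind1Passive.Setting.volumeLevel_passive ∧
  StatementOf @Summit.ABC.IUTFork.Ind1Passive.Setting.link
/-- discharge of `N_Fork_ForkInd1Passive`: the landed theorems it names, BY NAME (spec §2(c)); proves nothing new. -/
theorem N_Fork_ForkInd1Passive_holds : N_Fork_ForkInd1Passive := ⟨@Summit.ABC.IUTFork.Ind1Passive.Setting.passiveVol_smul, @Summit.ABC.IUTFork.Ind1Passive.Setting.passiveVol_le_activeVol, @Summit.ABC.IUTFork.Ind1Passive.Setting.activeVol_eq_passiveVol_of_invariant, @Summit.ABC.IUTFork.Ind1Passive.Setting.certified_iff, @Summit.ABC.IUTFork.Ind1Passive.Setting.setLevel_forces_active, @Summit.ABC.IUTFork.Ind1Passive.Setting.volumeLevel_passive, @Summit.ABC.IUTFork.Ind1Passive.Setting.link⟩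
example := @Summit.ABC.IUTFork.Ind1Passive.Setting
example := @Summit.ABC.IUTFork.Ind1Passive.Setting.activeVol
example := @Summit.ABC.IUTFork.Ind1Passive.Setting.passiveVol
example := @Summit.ABC.IUTFork.Ind1Passive.trivialSetting


end

end Summit.ABC.IUTFork.DAG
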